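import Literature.Analysis.UnboundedOperators.MildFlowDerivatives
import Summits.AnomalousDissipation.AnomalousDissipation.Theorems.BaireTransferDenseLoudDesignerForcesErgodicLine

/-!
# Joint continuity of the `y`-derivatives of the mild flow (tools stub `stub_mildFlowDerivativesContinuityTools`,
# block N-R, line `ergodic-budget-selection-closing`, crux `BaireTransfer.DenseLoudDesignerForces`,
# stmt-AnomalousDissipation-1143)

Summit-side copy of the Literature theorem
`Literature.Analysis.UnboundedOperators.continuousOn_fderiv_mildFlow`
(`Literature/Analysis/UnboundedOperators/MildFlowDerivatives.lean`, any real Banach space `E`): in the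
setting of the smooth local mild flow S4 / the tubes S4c / the linear mild flow T5 (`T` strongly continuous
contractions, norm continuous on `(0, ∞)`; `K` weakly singular, `‖K t‖ ≤ C t^{-α}` with `0 ≤ α < 1`,
strongly and norm continuous on `(0, ∞)`; `N` bounded bilinear; constant forcing `f`), let
`G : E → C([0, L]; E)` be a family of mild solutions

  `G y (t) = T(t) y + ∫₀ᵗ T(t − s) f ds − ∫₀ᵗ K(t − s) N(G y (s), G y (s)) ds`     (`y ∈ U` open)

which is continuous on `U` (the output of the tube cover `exists_open_mildFlow_of_isCompact`).  Then

* the first derivative field `(t, y) ↦ D_y[G y (t)] ∈ L(E)` is continuous on `(0, L] × U` in OPERATOR norm;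
* so is the second derivative field `(t, y) ↦ D_y²[G y (t)] ∈ L(E, L(E))`;
* for `y ∈ U`, `h ∈ E` the curve `w(t) = D_y[G y (t)] h` is continuous on `[0, L]` and solves the linearised
  mild equation `w(t) = T(t) h − ∫₀ᵗ K(t − s) (N(y(s), w(s)) + N(w(s), y(s))) ds` along `G y`.

These are the `y`-side inputs of the assembly of the joint `C²` regularity of the smooth model from partial
derivative fields (`Literature/Analysis/Calculus/JointSmoothnessPartials.lean`, `contDiffOn_succ_of_partial`).

Architecture of the proof (all in `Literature/Analysis/UnboundedOperators/`): the family `G` is `C^∞` on `U`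
AS A MAP INTO THE BANACH SPACE `C([0, L]; E)` (`MildFlowDerivativesCurve.lean`, Henry's Thm 3.4.4: implicit
function theorem for `w − (A y + F₀ − Φ N(w, w)) = 0`, whose linearisation `1 + P` is the linear Volterra
operator of T5, inverted by an exponential weight and a Neumann series in `MildFlowDerivativesResolvent.lean`;
the continuous branch `G` is the implicit function); the first and second variation identities follow by the
chain rule, and the joint operator-norm continuity from the continuity of `y ↦ DG(y)`, `y ↦ D²G(y)` plus the
uniform-in-the-source time modulus of the weakly singular Duhamel integral for a norm-continuous kernel
(`LinearMildFlowKernelContinuity.lean`, `LinearMildFlowSmall.lean`) — `MildFlowDerivatives.lean`.  The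
registered signature also carries the semigroup law `hT0`, `hTadd`, the intertwining `hKadd` and the per-time
smoothness `hGs`; the conclusions do not need them (per-time smoothness is implied by the curve-level one).

References: D. Henry, *Geometric Theory of Semilinear Parabolic Equations*, LNM 840 (1981), Thm 1.4.3,
Thm 3.4.4, Cor. 3.4.6, §7.1 (Lemma 7.1.1, Thm 7.1.3); A. Pazy, *Semigroups of Linear Operators and
Applications to PDE* (1983), Thm 2.6.13, Thm 6.3.1.  Nothing is asserted; no definition is added.
-/

-- `Summit.<Summit>.<Problem>` is the tree's mandated summit-side namespace (CONVENTIONS §2); for this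
-- single-conjunct summit the two coincide, so the duplicate is deliberate.
set_option linter.dupNamespace false

noncomputable section

open scoped BigOperators Topology ENNReal InnerProductSpace ContDiff
open Filter Set Function MeasureTheory

namespace Summit.AnomalousDissipation.AnomalousDissipation.Theorems.DenseLoudDesignerForces.Ergodic

open Literature.Analysis.FunctionSpaces Literature.Analysis.FunctionSpaces.Torus
open Literature.Analysis.FluidPDE Literature.Analysis.FluidPDE.Torus

/-- **Tools stub T6 of block N-R (`stub_mildFlowDerivativesContinuityTools`) — joint continuity in `(t, y)`
of the first and second `y`-derivatives of a continuous family of mild solutions, and the linearised mild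
identity of the first derivative.**  For strongly continuous contractions `T`, norm continuous on `(0, ∞)`,
a weakly singular `K` (`‖K t‖ ≤ C t^{-α}`, `0 ≤ α < 1`), strongly and norm continuous on `(0, ∞)`, `N`
bounded bilinear, `f ∈ E`, `L > 0` and `G : E → C([0, L]; E)` continuous on an open `U` with `G y` the mild
solution from `y` on `[0, L]` for `y ∈ U`: `(t, y) ↦ D_y[G y (t)]` and `(t, y) ↦ D_y²[G y (t)]` are
continuous on `(0, L] × U` in operator norm, and `t ↦ D_y[G y (t)] h` is continuous on `[0, L]` and solves
`w(t) = T t h − ∫₀ᵗ K(t − s) (N(G y s, w s) + N(w s, G y s)) ds` —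
`Literature.Analysis.UnboundedOperators.continuousOn_fderiv_mildFlow` (Henry 1981, Thm 3.4.4, Cor. 3.4.6,
§7.1). [cite: Henry1981, Thm 3.4.4 and Cor. 3.4.6] -/
theorem stub_mildFlowDerivativesContinuityTools {E : Type*} [NormedAddCommGroup E] [NormedSpace ℝ E] [CompleteSpace E]
    (T K : ℝ → E →L[ℝ] E) (hT0 : T 0 = 1) (hTadd : ∀ s t, 0 ≤ s → 0 ≤ t → T (s + t) = (T s).comp (T t))
    (hTnorm : ∀ t, 0 ≤ t → ‖T t‖ ≤ 1) (hTc : ∀ y : E, Continuous fun t : ℝ => T t y) (hTn : ContinuousOn T (Ioi 0))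
    {α C : ℝ} (hα₀ : 0 ≤ α) (hα : α < 1) (hC : 0 ≤ C) (hK : ∀ t, 0 < t → ‖K t‖ ≤ C * t ^ (-α))
    (hKadd : ∀ s t, 0 ≤ s → 0 < t → K (s + t) = (T s).comp (K t))
    (hKc : ∀ y : E, ContinuousOn (fun t : ℝ => K t y) (Ioi 0)) (hKn : ContinuousOn K (Ioi 0))
    (N : E →L[ℝ] E →L[ℝ] E) (f : E) {L : ℝ} (hL : 0 < L) {U : Set E} (hU : IsOpen U)
    (G : E → C(Icc (0 : ℝ) L, E)) (hGc : ContinuousOn G U) (hGs : ∀ t : Icc (0 : ℝ) L, ContDiffOn ℝ ∞ (fun y => G y t) U)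
    (hGm : ∀ y ∈ U, ∀ t : Icc (0 : ℝ) L, G y t = T t y + (∫ s in (0 : ℝ)..(t : ℝ), T ((t : ℝ) - s) f) -
      ∫ s in (0 : ℝ)..(t : ℝ), K ((t : ℝ) - s) (N (G y (Set.projIcc 0 L hL.le s)) (G y (Set.projIcc 0 L hL.le s)))) :
    ContinuousOn (fun q : ℝ × E => fderiv ℝ (fun y => G y (Set.projIcc 0 L hL.le q.1)) q.2) (Ioc 0 L ×ˢ U) ∧
    ContinuousOn (fun q : ℝ × E => fderiv ℝ (fun y => fderiv ℝ (fun y' => G y' (Set.projIcc 0 L hL.le q.1)) y) q.2) (Ioc 0 L ×ˢ U) ∧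
    (∀ y ∈ U, ∀ h : E, Continuous (fun t : Icc (0 : ℝ) L => fderiv ℝ (fun y' => G y' t) y h) ∧
      ∀ t : Icc (0 : ℝ) L, fderiv ℝ (fun y' => G y' t) y h = T t h -
        ∫ s in (0 : ℝ)..(t : ℝ), K ((t : ℝ) - s)
          (N (G y (Set.projIcc 0 L hL.le s)) (fderiv ℝ (fun y' => G y' (Set.projIcc 0 L hL.le s)) y h) +
            N (fderiv ℝ (fun y' => G y' (Set.projIcc 0 L hL.le s)) y h) (G y (Set.projIcc 0 L hL.le s)))) := by
  -- `hT0`, `hTadd`, `hKadd`, `hGs` belong to the registered signature; the Literature theorem does not need them.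
  have _h₀ : T 0 = 1 := hT0
  have _h₁ : ∀ s t, 0 ≤ s → 0 ≤ t → T (s + t) = (T s).comp (T t) := hTadd
  have _h₂ : ∀ s t, 0 ≤ s → 0 < t → K (s + t) = (T s).comp (K t) := hKadd
  have _h₃ : ∀ t : Icc (0 : ℝ) L, ContDiffOn ℝ ∞ (fun y => G y t) U := hGs
  exact Literature.Analysis.UnboundedOperators.continuousOn_fderiv_mildFlow T K hTnorm hTc hTn hα₀ hα hC hK hKc
    hKn N f hL hU G hGc hGm

end Summit.AnomalousDissipation.AnomalousDissipation.Theorems.DenseLoudDesignerForces.Ergodic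

end
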